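import Mathlib.Analysis.Convex.SimplicialComplex.Basic
import Mathlib.Analysis.Convex.StdSimplex
import Mathlib.Analysis.Normed.Module.FiniteDimension
import Mathlib.Algebra.Order.Floor.Ring
import Mathlib.Algebra.BigOperators.Fin
import Literature.Analysis.Convexity.SignArrangementChainComplex
import Literature.Analysis.Convexity.Nondegenerate
import HarnessLib

/-!
# Fine non-degenerate refinements of coordinate complexes (the lattice subdivision)

Munkres, *Elementary differential topology* (1966), Lemma 9.4: *a finite complex has arbitrarily
fine subdivisions whose simplices have thickness bounded away from zero.*  Munkres proves this
with the "standard subdivision" of a cube lattice (finitely many shapes up to translation).  We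
give a different, arrangement-theoretic construction for **coordinate complexes** — geometric
complexes in `ℝᴺ` whose vertices are coordinate vectors `e i`, i.e. canonical realisations of
finite abstract complexes (`IsCoordinate`) — which is all the triangulation programme needs:

* the **lattice arrangement** of mesh `1/m` (`latticeFun m`): the affine functionals
  `∑_{j ≤ i < j'} xᵢ - k/m` (block sums of consecutive coordinates minus multiples of `1/m`);
  its cells inside a coordinate simplex are small (`abs_sub_le_of_mem_cl_svec`: coordinates vary
  by `≤ 1/m` on a closed cell) and closed cells of points of a standard face stay in that face
  (`cl_svec_subset_stdFace`);
* the **lattice rounding** `roundPoint m p` of a point `p`: keep the integer parts of the scaled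
  cumulative sums `m ∑_{i<j} pᵢ` and replace their fractional parts by `rank / (N + 1)`; this
  preserves the sign vector (`svec_roundPoint`) and produces a point of the lattice
  `(m (N+1))⁻¹ ℤᴺ` (`exists_int_roundPoint`);
* the **lattice refinement** `latticeRefinement K m hm`: the chain triangulation
  (`SignArrangement.chainComplex`) of the lattice arrangement restricted to the faces inside
  `K.space`, with lattice roundings as chosen points.  It is a finite complex with the same
  underlying space (`latticeRefinement_space`), refines `K`
  (`exists_convexHull_subset_of_mem_latticeRefinement`), covers each simplex of `K` by simplices
  inside it (`exists_mem_latticeRefinement_of_mem`), has mesh `≤ 1/m`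
  (`abs_sub_le_of_mem_latticeRefinement`), lattice vertices
  (`exists_int_of_mem_latticeRefinement`), and therefore — by the finiteness theorem
  `exists_pos_forall_nondegenerate_of_int` of `Literature.Analysis.Convexity.Nondegenerate` — all
  its simplices are `c`-non-degenerate for a constant `c` **independent of `m`**
  (`nondegenerate_of_mem_latticeRefinement`);
* `exists_fine_nondegenerate_refinement` bundles these as Munkres 9.4.

All definitions have bodies; all statements are proved; no named facts are introduced.

## References

* J.R. Munkres, *Elementary differential topology*, Ann. of Math. Studies 54 (1963; rev. 1966),
  §9, Lemma 9.4. [Munkres1966]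
-/

open Set Function Finset

noncomputable section

namespace Literature.Analysis.Convexity

open SignArrangement

variable {N : ℕ}

/-! ### Coordinate simplices -/

section StdFace

/-- The standard face on the index set `I`: points of `ℝᴺ` with nonnegative coordinates summing
to `1` and vanishing off `I`. [folklore] -/
def stdFace (I : Set (Fin N)) : Set (Fin N → ℝ) :=
  {x | (∀ i, 0 ≤ x i) ∧ ∑ i, x i = 1 ∧ ∀ i, i ∉ I → x i = 0}

/-- Unfolding lemma for `stdFace`. [folklore] -/
theorem mem_stdFace_iff {I : Set (Fin N)} {x : Fin N → ℝ} :
    x ∈ stdFace I ↔ (∀ i, 0 ≤ x i) ∧ ∑ i, x i = 1 ∧ ∀ i, i ∉ I → x i = 0 := Iff.rfl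

/-- Standard faces are monotone in the index set. [folklore] -/
theorem stdFace_mono {I J : Set (Fin N)} (h : I ⊆ J) : stdFace I ⊆ stdFace J :=
  fun _ hx => ⟨hx.1, hx.2.1, fun i hi => hx.2.2 i fun hi' => hi (h hi')⟩

/-- Standard faces are convex. [folklore] -/
theorem convex_stdFace (I : Set (Fin N)) : Convex ℝ (stdFace I) := by
  intro x hx y hy a b ha hb hab
  refine ⟨fun i => ?_, ?_, fun i hi => ?_⟩
  · simp only [Pi.add_apply, Pi.smul_apply, smul_eq_mul]
    exact add_nonneg (mul_nonneg ha (hx.1 i)) (mul_nonneg hb (hy.1 i))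
  · simp only [Pi.add_apply, Pi.smul_apply, smul_eq_mul, Finset.sum_add_distrib,
      ← Finset.mul_sum, hx.2.1, hy.2.1, mul_one, hab]
  · simp only [Pi.add_apply, Pi.smul_apply, smul_eq_mul, hx.2.2 i hi, hy.2.2 i hi, mul_zero,
      add_zero]

/-- The coordinates of a point of a standard face lie in `[0, 1]`. [folklore] -/
theorem le_one_of_mem_stdFace {I : Set (Fin N)} {x : Fin N → ℝ} (hx : x ∈ stdFace I)
    (i : Fin N) : x i ≤ 1 := by
  rw [← hx.2.1]
  exact Finset.single_le_sum (fun j _ => hx.1 j) (Finset.mem_univ i)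

/-- **Convex hulls of coordinate vertices.** The convex hull of the vertices `e i`, `i ∈ I`, is
the standard face on `I`. [folklore] -/
theorem convexHull_image_single (I : Finset (Fin N)) :
    convexHull ℝ ((I.image fun i => (Pi.single i 1 : Fin N → ℝ)) : Set (Fin N → ℝ)) =
      stdFace (I : Set (Fin N)) := by
  classical
  refine Subset.antisymm (convexHull_min ?_ (convex_stdFace _)) fun x hx => ?_
  · intro v hv
    rw [Finset.coe_image] at hv
    obtain ⟨i, hi, rfl⟩ := hv
    refine ⟨fun j => ?_, ?_, fun j hj => ?_⟩
    · by_cases h : j = i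
      · subst h; simp
      · simp [Pi.single_eq_of_ne h]
    · simp [Finset.sum_pi_single']
    · have : j ≠ i := fun h => hj (h ▸ hi)
      simp [Pi.single_eq_of_ne this]
  · -- `x = ∑ i ∈ I, x i • e i` is a convex combination of the vertices
    have hx' : x = ∑ i ∈ I, x i • (Pi.single i 1 : Fin N → ℝ) := by
      ext j
      simp only [Finset.sum_apply, Pi.smul_apply, Pi.single_apply, smul_eq_mul, mul_ite, mul_one,
        mul_zero, Finset.sum_ite_eq]
      by_cases hj : j ∈ I
      · simp [hj]
      · simp [hj, hx.2.2 j (by simpa using hj)]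
    have hsum : ∑ i ∈ I, x i = 1 := by
      rw [← hx.2.1]
      exact Finset.sum_subset (Finset.subset_univ I) fun i _ hi => hx.2.2 i (by simpa using hi)
    rw [hx']
    refine (convex_convexHull ℝ _).sum_mem (fun i _ => hx.1 i) hsum fun i hi => ?_
    exact subset_convexHull ℝ _ (by rw [Finset.coe_image]; exact ⟨i, hi, rfl⟩)

/-- A finite set of coordinate vertices is the image of its index set. [folklore] -/
theorem eq_image_single_of_forall {s : Finset (Fin N → ℝ)}
    (hs : ∀ v ∈ s, ∃ i, v = Pi.single i 1) :
    ∃ I : Finset (Fin N), s = I.image fun i => (Pi.single i 1 : Fin N → ℝ) := by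
  classical
  refine ⟨Finset.univ.filter fun i => (Pi.single i 1 : Fin N → ℝ) ∈ s, ?_⟩
  ext v
  simp only [Finset.mem_image, Finset.mem_filter, Finset.mem_univ, true_and]
  constructor
  · intro hv
    obtain ⟨i, rfl⟩ := hs v hv
    exact ⟨i, hv, rfl⟩
  · rintro ⟨i, hi, rfl⟩
    exact hi

end StdFace

/-! ### The lattice arrangement -/

section Arrangement

/-- Cumulative coordinate sums `P j x = ∑_{i < j} x i` (`j : ℕ`). [folklore] -/
def cumSum (j : ℕ) : (Fin N → ℝ) →ₗ[ℝ] ℝ :=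
  ∑ i : Fin N, if (i : ℕ) < j then LinearMap.proj i else 0

/-- Evaluation of `cumSum`. [folklore] -/
theorem cumSum_apply (j : ℕ) (x : Fin N → ℝ) :
    cumSum j x = ∑ i : Fin N, if (i : ℕ) < j then x i else 0 := by
  simp only [cumSum, LinearMap.coe_sum, Finset.sum_apply]
  refine Finset.sum_congr rfl fun i _ => ?_
  split_ifs <;> simp

/-- `cumSum 0 = 0`. [folklore] -/
theorem cumSum_zero (x : Fin N → ℝ) : cumSum 0 x = 0 := by
  simp [cumSum_apply]

/-- Consecutive cumulative sums differ by a coordinate. [folklore] -/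
theorem cumSum_succ (i : Fin N) (x : Fin N → ℝ) : cumSum ((i : ℕ) + 1) x = cumSum i x + x i := by
  rw [cumSum_apply, cumSum_apply]
  have : ∀ l : Fin N, (if (l : ℕ) < (i : ℕ) + 1 then x l else 0) =
      (if (l : ℕ) < i then x l else 0) + if l = i then x i else 0 := fun l => by
    by_cases h1 : (l : ℕ) < i
    · have h2 : l ≠ i := fun h => by subst h; exact lt_irrefl _ h1
      simp [h1, Nat.lt_succ_of_lt h1, h2]
    · by_cases h2 : l = i
      · subst h2; simp
      · have h3 : ¬ (l : ℕ) < (i : ℕ) + 1 := fun h =>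
          h2 (Fin.ext (Nat.le_antisymm (Nat.lt_succ_iff.1 h) (not_lt.1 h1)))
        simp [h1, h2, h3]
  simp_rw [this, Finset.sum_add_distrib, Finset.sum_ite_eq' Finset.univ i, Finset.mem_univ,
    if_true]

/-- Beyond `N` the cumulative sum is the total sum. [folklore] -/
theorem cumSum_of_le {j : ℕ} (hj : N ≤ j) (x : Fin N → ℝ) : cumSum j x = ∑ i, x i := by
  rw [cumSum_apply]
  exact Finset.sum_congr rfl fun i _ => if_pos (i.2.trans_le hj)

/-- The functionals of the lattice arrangement of mesh `1/m` on `ℝᴺ`: block sums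
`∑_{j ≤ i < j'} x i - k / m`, indexed by `(j, j', k) ∈ Fin (N+1) × Fin (N+1) × Fin (m+1)`.
[folklore] -/
def latticeFun (m : ℕ) (p : Fin (N + 1) × Fin (N + 1) × Fin (m + 1)) : (Fin N → ℝ) →ᵃ[ℝ] ℝ :=
  (cumSum (p.2.1 : ℕ) - cumSum (p.1 : ℕ)).toAffineMap +
    AffineMap.const ℝ (Fin N → ℝ) (-((p.2.2 : ℕ) : ℝ) / m)

/-- Evaluation of the lattice functionals. [folklore] -/
theorem latticeFun_apply (m : ℕ) (p : Fin (N + 1) × Fin (N + 1) × Fin (m + 1)) (x : Fin N → ℝ) :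
    latticeFun m p x = cumSum (p.2.1 : ℕ) x - cumSum (p.1 : ℕ) x - ((p.2.2 : ℕ) : ℝ) / m := by
  simp [latticeFun]
  ring

/-- The coordinate functional `x i - k / m` is a lattice functional. [folklore] -/
theorem latticeFun_coord (m : ℕ) (i : Fin N) (k : Fin (m + 1)) (x : Fin N → ℝ) :
    latticeFun m (i.castSucc, i.succ, k) x = x i - ((k : ℕ) : ℝ) / m := by
  rw [latticeFun_apply]
  simp only [Fin.val_castSucc, Fin.val_succ, cumSum_succ]
  ring

/-- The total-sum functional `∑ x i - k / m` is a lattice functional. [folklore] -/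
theorem latticeFun_total (m : ℕ) (k : Fin (m + 1)) (x : Fin N → ℝ) :
    latticeFun m (0, Fin.last N, k) x = ∑ i, x i - ((k : ℕ) : ℝ) / m := by
  rw [latticeFun_apply]
  simp only [Fin.val_zero, Fin.val_last, cumSum_zero, sub_zero, cumSum_of_le le_rfl]

end Arrangement

/-! ### Sign comparison lemma -/

section Signs

/-- If `C` is an integer and `d, d' ∈ (-1, 1)` have the same sign, then `C + d` and `C + d'`
have the same sign. [folklore] -/
theorem sign_intCast_add_eq {C : ℤ} {d d' : ℝ} (hd : |d| < 1) (hd' : |d'| < 1)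
    (h : SignType.sign d = SignType.sign d') :
    SignType.sign ((C : ℝ) + d) = SignType.sign ((C : ℝ) + d') := by
  rw [abs_lt] at hd hd'
  rcases lt_trichotomy C 0 with hC | hC | hC
  · have hC' : (C : ℝ) ≤ -1 := by exact_mod_cast Int.le_sub_one_iff.2 hC
    rw [sign_neg (by linarith), sign_neg (by linarith)]
  · subst hC
    simpa using h
  · have hC' : (1 : ℝ) ≤ C := by exact_mod_cast hC
    rw [sign_pos (by linarith), sign_pos (by linarith)]

end Signs

/-! ### Lattice rounding of a point -/

section Rounding

variable (m : ℕ) (p : Fin N → ℝ)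

/-- Scaled cumulative sums `q j = m * P j p`. [folklore] -/
def qSum (j : ℕ) : ℝ := m * cumSum j p

/-- The set of nonzero fractional parts of the scaled cumulative sums `q 0, …, q N`.
[folklore] -/
def fracSet : Finset ℝ :=
  ((Finset.range (N + 1)).image fun j => Int.fract (qSum m p j)).filter fun r => r ≠ 0

/-- The rank of a real number among the nonzero fractional parts (number of them `≤ a`).
[folklore] -/
def fracRank (a : ℝ) : ℕ := ((fracSet m p).filter fun r => r ≤ a).card

/-- The rounded cumulative sums: integer part kept, fractional part replaced by
`rank / (N + 1)`. [folklore] -/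
def roundCum (j : ℕ) : ℝ :=
  ((⌊qSum m p j⌋ : ℝ) + (fracRank m p (Int.fract (qSum m p j)) : ℝ) / (N + 1)) / m

/-- **Lattice rounding.** The point of `ℝᴺ` whose cumulative sums are the rounded cumulative
sums of `p`. It has the same sign vector as `p` for the lattice arrangement and lies in the
lattice `(m (N+1))⁻¹ ℤᴺ`. [folklore] -/
def roundPoint : Fin N → ℝ := fun i => roundCum m p ((i : ℕ) + 1) - roundCum m p i

variable {m p}

/-- The fractional-part set has at most `N` elements (`q 0 = 0` has fractional part `0`).
[folklore] -/
theorem card_fracSet_le : (fracSet m p).card ≤ N := by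
  classical
  set S : Finset ℝ := (Finset.range (N + 1)).image fun j => Int.fract (qSum m p j) with hS
  have h0 : (0 : ℝ) ∈ S := by
    refine Finset.mem_image.2 ⟨0, by simp, ?_⟩
    simp [qSum, cumSum_zero]
  have hsub : fracSet m p ⊆ S.erase 0 := fun r hr => by
    rw [fracSet, Finset.mem_filter] at hr
    exact Finset.mem_erase.2 ⟨hr.2, hr.1⟩
  calc (fracSet m p).card ≤ (S.erase 0).card := Finset.card_le_card hsub
    _ = S.card - 1 := Finset.card_erase_of_mem h0
    _ ≤ (N + 1) - 1 := by
        gcongr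
        exact Finset.card_image_le.trans (by simp)
    _ = N := by simp

/-- Ranks are at most `N`. [folklore] -/
theorem fracRank_le (a : ℝ) : fracRank m p a ≤ N :=
  (Finset.card_le_card (Finset.filter_subset _ _)).trans card_fracSet_le

/-- Elements of `fracSet` are fractional parts in `(0, 1)`. [folklore] -/
theorem pos_of_mem_fracSet {r : ℝ} (hr : r ∈ fracSet m p) : 0 < r ∧ r < 1 := by
  rw [fracSet, Finset.mem_filter, Finset.mem_image] at hr
  obtain ⟨⟨j, -, rfl⟩, hne⟩ := hr
  exact ⟨lt_of_le_of_ne (Int.fract_nonneg _) (Ne.symm hne), Int.fract_lt_one _⟩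

/-- The rank of `0` (indeed of any nonpositive number) is `0`. [folklore] -/
theorem fracRank_eq_zero {a : ℝ} (ha : a ≤ 0) : fracRank m p a = 0 := by
  rw [fracRank, Finset.card_eq_zero, Finset.filter_eq_empty_iff]
  intro r hr hra
  exact (lt_irrefl _ (((pos_of_mem_fracSet hr).1.trans_le hra).trans_le ha)).elim

/-- The rank is monotone. [folklore] -/
theorem fracRank_mono {a a' : ℝ} (h : a ≤ a') : fracRank m p a ≤ fracRank m p a' :=
  Finset.card_le_card fun r hr => by
    rw [Finset.mem_filter] at hr ⊢
    exact ⟨hr.1, hr.2.trans h⟩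

/-- The rank is strictly monotone on `fracSet ∪ {0}` in the second argument: if `a < a'` and
`a' ∈ fracSet` then `fracRank a < fracRank a'`. [folklore] -/
theorem fracRank_lt {a a' : ℝ} (h : a < a') (ha' : a' ∈ fracSet m p) :
    fracRank m p a < fracRank m p a' := by
  refine Finset.card_lt_card ⟨fun r hr => ?_, fun hsub => ?_⟩
  · rw [Finset.mem_filter] at hr ⊢
    exact ⟨hr.1, hr.2.trans h.le⟩
  · have : a' ∈ (fracSet m p).filter fun r => r ≤ a := hsub (Finset.mem_filter.2 ⟨ha', le_rfl⟩)
    exact (lt_irrefl _ ((Finset.mem_filter.1 this).2.trans_lt h)).elim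

/-- The fractional part of `q j`, `j ≤ N`, is `0` or belongs to `fracSet`. [folklore] -/
theorem fract_qSum_mem {j : ℕ} (hj : j ≤ N) :
    Int.fract (qSum m p j) = 0 ∨ Int.fract (qSum m p j) ∈ fracSet m p := by
  classical
  by_cases h : Int.fract (qSum m p j) = 0
  · exact Or.inl h
  · refine Or.inr (Finset.mem_filter.2 ⟨Finset.mem_image.2 ⟨j, ?_, rfl⟩, h⟩)
    exact Finset.mem_range.2 (Nat.lt_succ_of_le hj)

/-- **Sign comparison of rank differences.** For `j, j' ≤ N` the differences of fractional
parts and of normalised ranks have the same sign. [folklore] -/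
theorem sign_fract_sub_eq {j j' : ℕ} (hj : j ≤ N) (hj' : j' ≤ N) :
    SignType.sign (Int.fract (qSum m p j') - Int.fract (qSum m p j)) =
      SignType.sign (((fracRank m p (Int.fract (qSum m p j')) : ℝ) -
        (fracRank m p (Int.fract (qSum m p j)) : ℝ)) / (N + 1)) := by
  have hN : (0 : ℝ) < N + 1 := by positivity
  set a := Int.fract (qSum m p j) with ha
  set a' := Int.fract (qSum m p j') with ha'
  have ha0 : 0 ≤ a := Int.fract_nonneg _
  have ha'0 : 0 ≤ a' := Int.fract_nonneg _
  rcases lt_trichotomy a a' with h | h | h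
  · have hmem : a' ∈ fracSet m p :=
      (fract_qSum_mem (m := m) (p := p) hj').resolve_left (ha0.trans_lt h).ne'
    have hr : (fracRank m p a : ℝ) < fracRank m p a' := by exact_mod_cast fracRank_lt h hmem
    rw [sign_pos (sub_pos.2 h), sign_pos (div_pos (sub_pos.2 hr) hN)]
  · rw [h, sub_self, sub_self, zero_div]
  · have hmem : a ∈ fracSet m p :=
      (fract_qSum_mem (m := m) (p := p) hj).resolve_left (ha'0.trans_lt h).ne'
    have hr : (fracRank m p a' : ℝ) < fracRank m p a := by exact_mod_cast fracRank_lt h hmem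
    rw [sign_neg (sub_neg.2 h), sign_neg (div_neg_of_neg_of_pos (sub_neg.2 hr) hN)]

/-- `roundCum 0 = 0`. [folklore] -/
theorem roundCum_zero : roundCum m p 0 = 0 := by
  simp [roundCum, qSum, cumSum_zero, fracRank_eq_zero (le_refl (0 : ℝ))]

/-- The cumulative sums of the rounded point are the rounded cumulative sums (`j ≤ N`).
[folklore] -/
theorem cumSum_roundPoint {j : ℕ} (hj : j ≤ N) : cumSum j (roundPoint m p) = roundCum m p j := by
  rw [cumSum_apply]
  have h1 : (∑ i : Fin N, if (i : ℕ) < j then roundPoint m p i else 0) =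
      ∑ i ∈ Finset.range N, if i < j then roundCum m p (i + 1) - roundCum m p i else 0 :=
    Fin.sum_univ_eq_sum_range
      (fun i => if i < j then roundCum m p (i + 1) - roundCum m p i else 0) N
  have h2 : (∑ i ∈ Finset.range N, if i < j then roundCum m p (i + 1) - roundCum m p i else 0) =
      ∑ i ∈ Finset.range j, (roundCum m p (i + 1) - roundCum m p i) := by
    rw [← Finset.sum_filter]
    congr 1
    ext i
    simp only [Finset.mem_filter, Finset.mem_range]
    omega
  rw [h1, h2, Finset.sum_range_sub, roundCum_zero, sub_zero]

/-- Arithmetic of the decomposition into integer and fractional parts. [folklore] -/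
theorem div_sub_div_sub_div_eq (hm : 0 < m) (q q' : ℝ) (k : ℕ) :
    q' / m - q / m - (k : ℝ) / m =
      (1 / m) * (((⌊q'⌋ - ⌊q⌋ - k : ℤ) : ℝ) + (Int.fract q' - Int.fract q)) := by
  have hm' : (m : ℝ) ≠ 0 := by exact_mod_cast hm.ne'
  rw [← Int.self_sub_floor, ← Int.self_sub_floor]
  push_cast
  field_simp
  ring

/-- The value of a lattice functional at `p`, in terms of integer and fractional parts of the
scaled cumulative sums. [folklore] -/
theorem latticeFun_apply_eq (hm : 0 < m) (jj : Fin (N + 1) × Fin (N + 1) × Fin (m + 1)) :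
    latticeFun m jj p = (1 / m) *
      (((⌊qSum m p jj.2.1⌋ - ⌊qSum m p jj.1⌋ - (jj.2.2 : ℕ) : ℤ) : ℝ) +
        (Int.fract (qSum m p jj.2.1) - Int.fract (qSum m p jj.1))) := by
  have hm' : (m : ℝ) ≠ 0 := by exact_mod_cast hm.ne'
  have h1 : cumSum (jj.2.1 : ℕ) p = qSum m p jj.2.1 / m := by
    rw [qSum, mul_div_cancel_left₀ _ hm']
  have h2 : cumSum (jj.1 : ℕ) p = qSum m p jj.1 / m := by
    rw [qSum, mul_div_cancel_left₀ _ hm']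
  rw [latticeFun_apply, h1, h2]
  exact div_sub_div_sub_div_eq hm _ _ _

/-- The value of a lattice functional at the rounded point. [folklore] -/
theorem latticeFun_roundPoint_eq (hm : 0 < m) (jj : Fin (N + 1) × Fin (N + 1) × Fin (m + 1)) :
    latticeFun m jj (roundPoint m p) = (1 / m) *
      (((⌊qSum m p jj.2.1⌋ - ⌊qSum m p jj.1⌋ - (jj.2.2 : ℕ) : ℤ) : ℝ) +
        ((fracRank m p (Int.fract (qSum m p jj.2.1)) : ℝ) / (N + 1) -
          (fracRank m p (Int.fract (qSum m p jj.1)) : ℝ) / (N + 1))) := by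
  have hm' : (m : ℝ) ≠ 0 := by exact_mod_cast hm.ne'
  rw [latticeFun_apply, cumSum_roundPoint (Nat.lt_succ_iff.1 jj.2.1.2),
    cumSum_roundPoint (Nat.lt_succ_iff.1 jj.1.2), roundCum, roundCum]
  push_cast
  field_simp
  ring

/-- **The rounded point has the same sign vector** for the lattice arrangement. [folklore] -/
theorem svec_roundPoint (hm : 0 < m) :
    svec (latticeFun m) (roundPoint m p) = svec (latticeFun (N := N) m) p := by
  funext jj
  rw [svec_apply, svec_apply, latticeFun_roundPoint_eq hm, latticeFun_apply_eq hm, sign_mul,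
    sign_mul]
  congr 1
  rw [← sub_div]
  refine (sign_intCast_add_eq ?_ ?_ (sign_fract_sub_eq (Nat.lt_succ_iff.1 jj.1.2)
    (Nat.lt_succ_iff.1 jj.2.1.2))).symm
  · -- `|fract - fract| < 1`
    rw [abs_lt]
    have h1 := Int.fract_nonneg (qSum m p jj.2.1)
    have h2 := Int.fract_lt_one (qSum m p jj.2.1)
    have h3 := Int.fract_nonneg (qSum m p jj.1)
    have h4 := Int.fract_lt_one (qSum m p jj.1)
    constructor <;> linarith
  · -- `|rank - rank| / (N + 1) < 1`
    have hN : (0 : ℝ) < N + 1 := by positivity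
    rw [abs_lt, lt_div_iff₀ hN, div_lt_iff₀ hN]
    have h1 : (fracRank m p (Int.fract (qSum m p jj.2.1)) : ℝ) ≤ N := by
      exact_mod_cast fracRank_le _
    have h2 : (fracRank m p (Int.fract (qSum m p jj.1)) : ℝ) ≤ N := by
      exact_mod_cast fracRank_le _
    have h3 : (0 : ℝ) ≤ fracRank m p (Int.fract (qSum m p jj.2.1)) := Nat.cast_nonneg _
    have h4 : (0 : ℝ) ≤ fracRank m p (Int.fract (qSum m p jj.1)) := Nat.cast_nonneg _
    constructor <;> linarith

/-- **The rounded point is a lattice point** of `(m (N+1))⁻¹ ℤᴺ`. [folklore] -/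
theorem exists_int_roundPoint (hm : 0 < m) (i : Fin N) :
    ∃ z : ℤ, ((m : ℝ) * (N + 1)) * roundPoint m p i = z := by
  have hm' : (m : ℝ) ≠ 0 := by exact_mod_cast hm.ne'
  have hN : (N + 1 : ℝ) ≠ 0 := by positivity
  refine ⟨((N + 1) * ⌊qSum m p ((i : ℕ) + 1)⌋ + fracRank m p (Int.fract (qSum m p ((i : ℕ) + 1))))
    - ((N + 1) * ⌊qSum m p i⌋ + fracRank m p (Int.fract (qSum m p i))), ?_⟩
  simp only [roundPoint, roundCum]
  push_cast
  field_simp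

end Rounding


/-! ### Coordinate complexes -/

section Coordinate

/-- A *coordinate complex*: a geometric simplicial complex in `ℝᴺ` all of whose vertices are
coordinate vectors `e i` (the canonical realisation of a finite abstract complex). [folklore] -/
def IsCoordinate (K : Geometry.SimplicialComplex ℝ (Fin N → ℝ)) : Prop :=
  ∀ s ∈ K.faces, ∀ v ∈ s, ∃ i, v = Pi.single i 1

variable {K : Geometry.SimplicialComplex ℝ (Fin N → ℝ)}

/-- A coordinate complex is finite. [folklore] -/
theorem IsCoordinate.faces_finite (hK : IsCoordinate K) : K.faces.Finite := by
  classical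
  refine ((Finset.univ.image fun i : Fin N => (Pi.single i 1 : Fin N → ℝ)).powerset.finite_toSet).subset
    fun s hs => ?_
  refine Finset.mem_coe.2 (Finset.mem_powerset.2 fun v hv => ?_)
  obtain ⟨i, rfl⟩ := hK s hs v hv
  exact Finset.mem_image.2 ⟨i, Finset.mem_univ i, rfl⟩

/-- The faces of a coordinate complex are standard faces. [folklore] -/
theorem IsCoordinate.exists_eq_stdFace (hK : IsCoordinate K) {s : Finset (Fin N → ℝ)}
    (hs : s ∈ K.faces) : ∃ I : Finset (Fin N), (s = I.image fun i => (Pi.single i 1 : Fin N → ℝ)) ∧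
      convexHull ℝ (s : Set (Fin N → ℝ)) = stdFace (I : Set (Fin N)) := by
  obtain ⟨I, rfl⟩ := eq_image_single_of_forall (hK s hs)
  exact ⟨I, rfl, convexHull_image_single I⟩

/-- The underlying space of a coordinate complex lies in the standard simplex. [folklore] -/
theorem IsCoordinate.space_subset_stdFace (hK : IsCoordinate K) :
    K.space ⊆ stdFace (Set.univ : Set (Fin N)) := fun x hx => by
  obtain ⟨s, hs, hxs⟩ := Geometry.SimplicialComplex.mem_space_iff.1 hx
  obtain ⟨I, -, hI⟩ := hK.exists_eq_stdFace hs
  rw [hI] at hxs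
  exact stdFace_mono (Set.subset_univ _) hxs

/-- The underlying space of a coordinate complex is compact. [folklore] -/
theorem IsCoordinate.isCompact_space (hK : IsCoordinate K) : IsCompact K.space := by
  have : K.space = ⋃ s ∈ K.faces, convexHull ℝ (s : Set (Fin N → ℝ)) := rfl
  rw [this]
  exact hK.faces_finite.isCompact_biUnion fun s _ => s.finite_toSet.isCompact_convexHull ℝ

/-- If `x` lies in the underlying space of a coordinate complex, so does the whole standard face
of every index set containing the support of `x` inside a face containing `x`; in the form
used below: the standard face of the support pattern of `x` lies in `K.space`. [folklore] -/
theorem IsCoordinate.stdFace_subset_space (hK : IsCoordinate K) {x : Fin N → ℝ}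
    (hx : x ∈ K.space) : stdFace {i | x i ≠ 0} ⊆ K.space := by
  obtain ⟨s, hs, hxs⟩ := Geometry.SimplicialComplex.mem_space_iff.1 hx
  obtain ⟨I, -, hI⟩ := hK.exists_eq_stdFace hs
  rw [hI] at hxs
  intro y hy
  refine Geometry.SimplicialComplex.mem_space_iff.2 ⟨s, hs, ?_⟩
  rw [hI]
  refine stdFace_mono (fun i hi => ?_) hy
  by_contra hiI
  exact hi (hxs.2.2 i hiI)

end Coordinate

/-! ### Closed faces of the lattice arrangement -/

section Faces

variable {m : ℕ}

/-- The closed face of the sign vector of a point `p` of a standard face lies in that standard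
face (signs of the coordinate functionals and of the total-sum functional). [folklore] -/
theorem cl_svec_subset_stdFace (hm : 0 < m) {I : Set (Fin N)} {p : Fin N → ℝ}
    (hp : p ∈ stdFace I) : cl (latticeFun m) (svec (latticeFun m) p) ⊆ stdFace I := by
  intro y hy
  have hcoord : ∀ i, SignType.sign (y i) = 0 ∨ SignType.sign (y i) = SignType.sign (p i) := by
    intro i
    have h := hy (i.castSucc, i.succ, 0)
    simp only [svec_apply, latticeFun_coord, Fin.val_zero, Nat.cast_zero, zero_div, sub_zero]
      at h
    exact h
  refine ⟨fun i => ?_, ?_, fun i hi => ?_⟩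
  · rcases hcoord i with h | h
    · exact (sign_eq_zero_iff.1 h).ge
    · rcases (hp.1 i).lt_or_eq with hpi | hpi
      · rw [sign_pos hpi] at h
        exact (sign_eq_one_iff.1 h).le
      · rw [← hpi, sign_zero] at h
        exact (sign_eq_zero_iff.1 h).ge
  · have h := hy (0, Fin.last N, Fin.last m)
    have hm' : ((m : ℕ) : ℝ) / m = 1 := div_self (by exact_mod_cast hm.ne')
    simp only [svec_apply, latticeFun_total, Fin.val_last, hm', hp.2.1, sub_self, sign_zero]
      at h
    have h0 : SignType.sign (∑ i, y i - 1) = 0 := by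
      rcases h with h | h <;> exact h
    linarith [sign_eq_zero_iff.1 h0]
  · rcases hcoord i with h | h
    · exact sign_eq_zero_iff.1 h
    · rw [hp.2.2 i hi, sign_zero] at h
      exact sign_eq_zero_iff.1 h

/-- **Closed cells are small.** Two points of the closed face of the sign vector of a point `p`
with coordinates in `[0, 1]` have coordinates differing by at most `1/m`. [folklore] -/
theorem abs_sub_le_of_mem_cl_svec (hm : 0 < m) {p : Fin N → ℝ} (hp0 : ∀ i, 0 ≤ p i)
    (hp1 : ∀ i, p i ≤ 1) {y y' : Fin N → ℝ} (hy : y ∈ cl (latticeFun m) (svec (latticeFun m) p))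
    (hy' : y' ∈ cl (latticeFun m) (svec (latticeFun m) p)) (i : Fin N) :
    |y i - y' i| ≤ 1 / m := by
  have hmR : (0 : ℝ) < m := by exact_mod_cast hm
  -- the sign condition for the coordinate functional `x i - k/m`
  have hsgn : ∀ (z : Fin N → ℝ), z ∈ cl (latticeFun m) (svec (latticeFun m) p) →
      ∀ k : Fin (m + 1), SignType.sign (z i - (k : ℕ) / m) = 0 ∨
        SignType.sign (z i - (k : ℕ) / m) = SignType.sign (p i - (k : ℕ) / m) := by
    intro z hz k
    have h := hz (i.castSucc, i.succ, k)
    simp only [svec_apply, latticeFun_coord] at h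
    exact h
  -- `k = ⌊m pᵢ⌋`
  obtain ⟨k, hk0, hkm, hk⟩ : ∃ k : ℕ, 0 ≤ k ∧ k ≤ m ∧ (k : ℝ) ≤ m * p i ∧ m * p i < k + 1 := by
    refine ⟨⌊(m : ℝ) * p i⌋.toNat, Nat.zero_le _, ?_, ?_, ?_⟩
    · have : ⌊(m : ℝ) * p i⌋ ≤ m := by
        refine Int.floor_le_iff.2 ?_
        have := hp1 i
        push_cast
        nlinarith
      omega
    · have h1 : (⌊(m : ℝ) * p i⌋ : ℝ) ≤ m * p i := Int.floor_le _
      have h2 : (0 : ℤ) ≤ ⌊(m : ℝ) * p i⌋ := Int.floor_nonneg.2 (mul_nonneg hmR.le (hp0 i))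
      have : ((⌊(m : ℝ) * p i⌋.toNat : ℕ) : ℝ) = (⌊(m : ℝ) * p i⌋ : ℝ) := by
        exact_mod_cast Int.toNat_of_nonneg h2
      rw [this]; exact h1
    · have h1 : (m : ℝ) * p i < ⌊(m : ℝ) * p i⌋ + 1 := Int.lt_floor_add_one _
      have h2 : (0 : ℤ) ≤ ⌊(m : ℝ) * p i⌋ := Int.floor_nonneg.2 (mul_nonneg hmR.le (hp0 i))
      have : ((⌊(m : ℝ) * p i⌋.toNat : ℕ) : ℝ) = (⌊(m : ℝ) * p i⌋ : ℝ) := by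
        exact_mod_cast Int.toNat_of_nonneg h2
      rw [this]; exact h1
  -- all points of the closed cell have `i`-th coordinate in `[k/m, (k+1)/m]` (or equal to `k/m`)
  have key : ∀ (z : Fin N → ℝ), z ∈ cl (latticeFun m) (svec (latticeFun m) p) →
      (k : ℝ) / m ≤ z i ∧ z i ≤ ((k : ℝ) + 1) / m := by
    intro z hz
    have hpk : (k : ℝ) / m ≤ p i := by rw [div_le_iff₀ hmR]; linarith
    rcases hpk.lt_or_eq with hlt | heq
    · -- `p i > k/m`: then `k + 1 ≤ m`, use the functionals at `k` and `k + 1`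
      have hk1 : k + 1 ≤ m := by
        by_contra hcon
        have hkm' : k = m := by omega
        subst hkm'
        have : p i ≤ 1 := hp1 i
        have : (1 : ℝ) < p i := by
          rw [div_self hmR.ne'] at hlt
          exact hlt
        linarith
      constructor
      · have h := hsgn z hz ⟨k, by omega⟩
        simp only at h
        rw [sign_pos (sub_pos.2 hlt)] at h
        rcases h with h | h
        · linarith [sign_eq_zero_iff.1 h]
        · exact (sub_pos.1 (sign_eq_one_iff.1 h)).le
      · have hlt' : p i < ((k : ℝ) + 1) / m := by rw [lt_div_iff₀ hmR]; linarith
        have h := hsgn z hz ⟨k + 1, by omega⟩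
        simp only [Nat.cast_add, Nat.cast_one] at h
        rw [sign_neg (sub_neg.2 hlt')] at h
        rcases h with h | h
        · linarith [sign_eq_zero_iff.1 h]
        · exact (sub_neg.1 (sign_eq_neg_one_iff.1 h)).le
    · -- `p i = k/m`: then `z i = k/m`
      have h := hsgn z hz ⟨k, by omega⟩
      simp only at h
      rw [← heq, sub_self, sign_zero, or_self] at h
      have hz' : z i = k / m := by linarith [sign_eq_zero_iff.1 h]
      rw [hz']
      constructor
      · exact le_rfl
      · gcongr; linarith
  obtain ⟨h1, h2⟩ := key y hy
  obtain ⟨h3, h4⟩ := key y' hy'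
  rw [abs_le]
  constructor
  · have : ((k : ℝ) + 1) / m - (k : ℝ) / m = 1 / m := by field_simp; ring
    linarith
  · have : ((k : ℝ) + 1) / m - (k : ℝ) / m = 1 / m := by field_simp; ring
    linarith

end Faces

/-! ### The lattice refinement -/

section Refinement

variable (K : Geometry.SimplicialComplex ℝ (Fin N → ℝ)) (m : ℕ)

/-- The admissible sign vectors: nonempty faces of the lattice arrangement inside `K.space`.
[folklore] -/
def latticePhi : Finset (Fin (N + 1) × Fin (N + 1) × Fin (m + 1) → SignType) := by
  classical
  exact Finset.univ.filter fun ε =>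
    (face (latticeFun (N := N) m) ε).Nonempty ∧ face (latticeFun m) ε ⊆ K.space

/-- The chosen points: the lattice rounding of some point of the face. [folklore] -/
def latticeB (ε : Fin (N + 1) × Fin (N + 1) × Fin (m + 1) → SignType) : Fin N → ℝ := by
  classical
  exact if h : (face (latticeFun (N := N) m) ε).Nonempty then roundPoint m h.some else 0

variable {K m}

/-- Membership in `latticePhi`. [folklore] -/
theorem mem_latticePhi {ε : Fin (N + 1) × Fin (N + 1) × Fin (m + 1) → SignType} :
    ε ∈ latticePhi K m ↔ (face (latticeFun m) ε).Nonempty ∧ face (latticeFun m) ε ⊆ K.space := by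
  classical
  simp [latticePhi]

/-- The chosen points lie in their faces. [folklore] -/
theorem latticeB_mem (hm : 0 < m) :
    ∀ ε ∈ latticePhi K m, latticeB m ε ∈ face (latticeFun m) ε := by
  classical
  intro ε hε
  obtain ⟨hne, -⟩ := mem_latticePhi.1 hε
  simp only [latticeB, dif_pos hne]
  have hp : hne.some ∈ face (latticeFun m) ε := hne.some_mem
  show svec (latticeFun m) (roundPoint m hne.some) = ε
  rw [svec_roundPoint hm]
  exact hp

/-- The chosen points are lattice points of `(m (N+1))⁻¹ ℤᴺ`. [folklore] -/
theorem exists_int_latticeB (hm : 0 < m) {ε : Fin (N + 1) × Fin (N + 1) × Fin (m + 1) → SignType}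
    (hε : ε ∈ latticePhi K m) (i : Fin N) : ∃ z : ℤ, ((m : ℝ) * (N + 1)) * latticeB m ε i = z := by
  classical
  obtain ⟨hne, -⟩ := mem_latticePhi.1 hε
  simp only [latticeB, dif_pos hne]
  exact exists_int_roundPoint hm i

/-- The sign vector of every point of `K.space` is admissible. [folklore] -/
theorem svec_mem_latticePhi (hK : IsCoordinate K) (hm : 0 < m) {x : Fin N → ℝ}
    (hx : x ∈ K.space) : svec (latticeFun m) x ∈ latticePhi K m := by
  refine mem_latticePhi.2 ⟨⟨x, mem_face_svec x⟩, ?_⟩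
  refine (face_subset_cl.trans (cl_svec_subset_stdFace hm (I := {i | x i ≠ 0}) ?_)).trans
    (hK.stdFace_subset_space hx)
  have hx' := hK.space_subset_stdFace hx
  exact ⟨hx'.1, hx'.2.1, fun i hi => by simpa using hi⟩

/-- Closed admissible faces lie in `K.space`. [folklore] -/
theorem cl_subset_space_of_mem_latticePhi (hK : IsCoordinate K) (hm : 0 < m)
    {ε : Fin (N + 1) × Fin (N + 1) × Fin (m + 1) → SignType} (hε : ε ∈ latticePhi K m) :
    cl (latticeFun m) ε ⊆ K.space := by
  obtain ⟨⟨p, hp⟩, hsub⟩ := mem_latticePhi.1 hε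
  have hpK : p ∈ K.space := hsub hp
  rw [← show svec (latticeFun m) p = ε from hp]
  refine (cl_svec_subset_stdFace hm (I := {i | p i ≠ 0}) ?_).trans (hK.stdFace_subset_space hpK)
  have hp' := hK.space_subset_stdFace hpK
  exact ⟨hp'.1, hp'.2.1, fun i hi => by simpa using hi⟩

/-- `latticePhi` is closed under passing to smaller sign vectors with nonempty faces. [folklore] -/
theorem latticePhi_down (hK : IsCoordinate K) (hm : 0 < m) :
    ∀ ε ∈ latticePhi K m, ∀ ε', SLE ε' ε → (face (latticeFun m) ε').Nonempty →
      ε' ∈ latticePhi K m := fun _ hε _ hle hne =>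
  mem_latticePhi.2 ⟨hne, (face_subset_cl.trans (cl_mono hle)).trans
    (cl_subset_space_of_mem_latticePhi hK hm hε)⟩

/-- The closed admissible faces are bounded. [folklore] -/
theorem latticePhi_bdd (hK : IsCoordinate K) (hm : 0 < m) :
    ∀ ε ∈ latticePhi K m, Bornology.IsBounded (cl (latticeFun m) ε) := fun _ hε =>
  hK.isCompact_space.isBounded.subset (cl_subset_space_of_mem_latticePhi hK hm hε)

variable (K m) in
/-- **The lattice refinement** of mesh `1/m` of the coordinate complex `K`: the chain
triangulation of the lattice arrangement restricted to the faces inside `K.space`, with lattice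
chosen points. [folklore] -/
def latticeRefinement (hm : 0 < m) : Geometry.SimplicialComplex ℝ (Fin N → ℝ) :=
  chainComplex (latticeFun m) (latticePhi K m) (latticeB m) (latticeB_mem hm)

variable {hm : 0 < m}

/-- The lattice refinement is finite. [folklore] -/
theorem latticeRefinement_faces_finite : (latticeRefinement K m hm).faces.Finite :=
  chainComplex_faces_finite

/-- Every simplex of the lattice refinement lies in the closed cell of an admissible sign vector
realised by a point of `K.space`, one of whose roundings is a vertex of the simplex. [folklore] -/
theorem exists_subset_cl_of_mem_latticeRefinement {t : Finset (Fin N → ℝ)}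
    (ht : t ∈ (latticeRefinement K m hm).faces) :
    ∃ p ∈ K.space, convexHull ℝ (t : Set (Fin N → ℝ)) ⊆ cl (latticeFun m) (svec (latticeFun m) p) := by
  classical
  obtain ⟨ε, hε, -, hsub⟩ := convexHull_subset_cl_of_mem_chainComplex_faces ht
  obtain ⟨⟨p, hp⟩, hsubK⟩ := mem_latticePhi.1 hε
  exact ⟨p, hsubK hp, by rwa [show svec (latticeFun m) p = ε from hp]⟩

/-- **Refinement.** Every simplex of the lattice refinement lies in a simplex of `K`. [folklore] -/
theorem exists_convexHull_subset_of_mem_latticeRefinement (hK : IsCoordinate K)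
    {t : Finset (Fin N → ℝ)} (ht : t ∈ (latticeRefinement K m hm).faces) :
    ∃ s ∈ K.faces, convexHull ℝ (t : Set (Fin N → ℝ)) ⊆ convexHull ℝ (s : Set (Fin N → ℝ)) := by
  obtain ⟨p, hp, hsub⟩ := exists_subset_cl_of_mem_latticeRefinement ht
  obtain ⟨s, hs, hps⟩ := Geometry.SimplicialComplex.mem_space_iff.1 hp
  obtain ⟨I, -, hI⟩ := hK.exists_eq_stdFace hs
  refine ⟨s, hs, hsub.trans ?_⟩
  rw [hI] at hps ⊢
  exact cl_svec_subset_stdFace hm hps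

/-- **Covering, simplexwise.** Every point of a simplex `s` of `K` lies in a simplex of the
lattice refinement contained in `s`. [folklore] -/
theorem exists_mem_latticeRefinement_of_mem (hK : IsCoordinate K) {s : Finset (Fin N → ℝ)}
    (hs : s ∈ K.faces) {x : Fin N → ℝ} (hx : x ∈ convexHull ℝ (s : Set (Fin N → ℝ))) :
    ∃ t ∈ (latticeRefinement K m hm).faces, x ∈ convexHull ℝ (t : Set (Fin N → ℝ)) ∧
      convexHull ℝ (t : Set (Fin N → ℝ)) ⊆ convexHull ℝ (s : Set (Fin N → ℝ)) := by
  classical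
  have hxK : x ∈ K.space := Geometry.SimplicialComplex.convexHull_subset_space hs hx
  obtain ⟨t, ht, -, hxt, hsub⟩ := exists_face_of_mem_face (latticePhi_down hK hm)
    (latticePhi_bdd hK hm) (svec_mem_latticePhi hK hm hxK) (mem_face_svec x)
  obtain ⟨I, -, hI⟩ := hK.exists_eq_stdFace hs
  refine ⟨t, ht, hxt, hsub.trans ?_⟩
  rw [hI] at hx ⊢
  exact cl_svec_subset_stdFace hm hx

/-- The lattice refinement has the same underlying space as `K`. [folklore] -/
theorem latticeRefinement_space (hK : IsCoordinate K) : (latticeRefinement K m hm).space = K.space := by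
  refine Subset.antisymm (fun x hx => ?_) (fun x hx => ?_)
  · obtain ⟨t, ht, hxt⟩ := Geometry.SimplicialComplex.mem_space_iff.1 hx
    obtain ⟨s, hs, hsub⟩ := exists_convexHull_subset_of_mem_latticeRefinement hK ht
    exact Geometry.SimplicialComplex.convexHull_subset_space hs (hsub hxt)
  · obtain ⟨s, hs, hxs⟩ := Geometry.SimplicialComplex.mem_space_iff.1 hx
    obtain ⟨t, ht, hxt, -⟩ := exists_mem_latticeRefinement_of_mem hK hs hxs
    exact Geometry.SimplicialComplex.convexHull_subset_space ht hxt

/-- **Mesh.** Points of one simplex of the lattice refinement have coordinates differing by at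
most `1/m`. [folklore] -/
theorem abs_sub_le_of_mem_latticeRefinement (hK : IsCoordinate K) {t : Finset (Fin N → ℝ)}
    (ht : t ∈ (latticeRefinement K m hm).faces) {y y' : Fin N → ℝ}
    (hy : y ∈ convexHull ℝ (t : Set (Fin N → ℝ))) (hy' : y' ∈ convexHull ℝ (t : Set (Fin N → ℝ)))
    (i : Fin N) : |y i - y' i| ≤ 1 / m := by
  obtain ⟨p, hp, hsub⟩ := exists_subset_cl_of_mem_latticeRefinement ht
  have hp' := hK.space_subset_stdFace hp
  exact abs_sub_le_of_mem_cl_svec hm hp'.1 (le_one_of_mem_stdFace hp') (hsub hy) (hsub hy') i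

/-- **Lattice vertices.** The vertices of the lattice refinement lie in `(m (N+1))⁻¹ ℤᴺ`.
[folklore] -/
theorem exists_int_of_mem_latticeRefinement {t : Finset (Fin N → ℝ)}
    (ht : t ∈ (latticeRefinement K m hm).faces) {v : Fin N → ℝ} (hv : v ∈ t) (i : Fin N) :
    ∃ z : ℤ, ((m : ℝ) * (N + 1)) * v i = z := by
  obtain ⟨G, hG, rfl⟩ := exists_eq_of_mem_of_mem_chainComplex_faces ht hv
  exact exists_int_latticeB hm hG i

/-- **Uniform non-degeneracy.** With the constant `c` of
`exists_pos_forall_nondegenerate_of_int N (N + 1)` — independent of `m` — every simplex of every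
lattice refinement of `K` is `c`-non-degenerate. [folklore] -/
theorem nondegenerate_of_mem_latticeRefinement (hK : IsCoordinate K) {c : ℝ}
    (hc : ∀ t : Finset (Fin N → ℝ), (∀ v ∈ t, ∀ i, ∃ z : ℤ, |z| ≤ ((N + 1 : ℕ) : ℤ) ∧ v i = z) →
      AffineIndependent ℝ ((↑) : t → (Fin N → ℝ)) → Nondegenerate c t)
    {t : Finset (Fin N → ℝ)} (ht : t ∈ (latticeRefinement K m hm).faces) : Nondegenerate c t := by
  have hmR : (0 : ℝ) < m := by exact_mod_cast hm
  refine nondegenerate_of_lattice (B := N + 1) hc (M := (m : ℝ) * (N + 1)) (by positivity)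
    ((latticeRefinement K m hm).indep ht) (fun v hv i => exists_int_of_mem_latticeRefinement ht hv i)
    fun u hu u' hu' i => ?_
  have h := abs_sub_le_of_mem_latticeRefinement hK ht (subset_convexHull ℝ _ hu)
    (subset_convexHull ℝ _ hu') i
  calc (m : ℝ) * (N + 1) * |u i - u' i| ≤ (m : ℝ) * (N + 1) * (1 / m) := by gcongr
    _ = (N + 1 : ℕ) := by push_cast; field_simp

/-- **Fine non-degenerate subdivisions of a coordinate complex** (Munkres (1966), Lemma 9.4, via
the lattice arrangement instead of the standard subdivision). For a coordinate complex `K` in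
`ℝᴺ` there is `c > 0` such that for every `m > 0` the lattice refinement of mesh `1/m` is a
finite simplicial complex with the same underlying space, refining `K` and covering each simplex
of `K` by simplices inside it, all of whose simplices have coordinate-diameter `≤ 1/m` and are
`c`-non-degenerate. [cite: Munkres1966, Lemma 9.4] -/
theorem exists_fine_nondegenerate_refinement (hK : IsCoordinate K) :
    ∃ c > 0, ∀ m : ℕ, 0 < m → ∃ P : Geometry.SimplicialComplex ℝ (Fin N → ℝ),
      P.faces.Finite ∧ P.space = K.space ∧
      (∀ t ∈ P.faces, ∃ s ∈ K.faces,
        convexHull ℝ (t : Set (Fin N → ℝ)) ⊆ convexHull ℝ (s : Set (Fin N → ℝ))) ∧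
      (∀ s ∈ K.faces, ∀ x ∈ convexHull ℝ (s : Set (Fin N → ℝ)), ∃ t ∈ P.faces,
        x ∈ convexHull ℝ (t : Set (Fin N → ℝ)) ∧
          convexHull ℝ (t : Set (Fin N → ℝ)) ⊆ convexHull ℝ (s : Set (Fin N → ℝ))) ∧
      (∀ t ∈ P.faces, ∀ y ∈ convexHull ℝ (t : Set (Fin N → ℝ)),
        ∀ y' ∈ convexHull ℝ (t : Set (Fin N → ℝ)), ∀ i, |y i - y' i| ≤ 1 / m) ∧
      (∀ t ∈ P.faces, ∀ v ∈ t, ∀ i, ∃ z : ℤ, ((m : ℝ) * (N + 1)) * v i = z) ∧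
      (∀ t ∈ P.faces, Nondegenerate c t) := by
  obtain ⟨c, hc, hcnd⟩ := exists_pos_forall_nondegenerate_of_int N (N + 1)
  refine ⟨c, hc, fun m hm => ⟨latticeRefinement K m hm, latticeRefinement_faces_finite,
    latticeRefinement_space hK,
    fun t ht => exists_convexHull_subset_of_mem_latticeRefinement hK ht,
    fun s hs x hx => exists_mem_latticeRefinement_of_mem hK hs hx,
    fun t ht y hy y' hy' i => abs_sub_le_of_mem_latticeRefinement hK ht hy hy' i,
    fun t ht v hv i => exists_int_of_mem_latticeRefinement ht hv i,
    fun t ht => nondegenerate_of_mem_latticeRefinement hK (fun t h1 h2 => hcnd t ?_ h2) ht⟩⟩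
  intro v hv i
  obtain ⟨z, hz, hvz⟩ := h1 v hv i
  exact ⟨z, by exact_mod_cast hz, hvz⟩

end Refinement

end Literature.Analysis.Convexity
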